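import Mathlib
import HarnessLib
import Summits.HubbardSuperconductivity.HubbardSuperconductivity.Theorems.KLProgrammeKLRegimeEnginePairLadderTowerComposeSet
import Summits.HubbardSuperconductivity.HubbardSuperconductivity.Theorems.KLProgrammeKLRegimeSplitSlotsV17F2

/-!
# Route `KLProgramme` — crux K3, ENGINE child gen 7/8-flow (stmt-HubbardSuperconductivity-20368 `KLRegimeEngineV17F` → its `…V17F2` successor), stub `stub_engine_step_values`,
# conjunct (E2-F2) at `1 ≤ n`: the forward tower door on the flowing-frame slot (cured bundle `klPredsV17F2`) — `pairLadderStepAtV17F2_of_wickTower_fwd`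

Cell gate-hubbard-kl, seat hubbard-kl-k3c1-p1 (g7), technique «composed-map remainder propagation».  Twin of `pairLadderStepAtV10_of_wickTower_fwd` (p518064)
for the gen-7/8-flow engine slot `PairLadderStepAtV17F2` (`…SplitSlotsV17F2` p527694 = S1 rev 2, k3c2-p2's cure 1: the resummed array is `klPairArrayF … (n−1) Qm` — the
amplitude at frame `K_{n−1}` truncated on the BARE ball `klBall L μ 0` — and the entries are read at frame `K_n` on the same bare ball; budget line
`+ frameShiftBar P Q U n`, leg count at `K_n`).  Instance of `kltc_compose_fwd_on` (p526646) with `B := klBall L μ 0`, `C₀ := klPairArrayF … (n−1) Qm`,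
`C₁ := klPairArrayF … n Qm`: per pair class the taker supplies ball-restricted Wick arrays `X, Y` (any matrices vanishing off `B²`), real weights `b′, w₁, b`,
the forward straddle relations against `klPairArrayF (n−1)` / `klPairArrayF n`, error majorants on `B²`, intermediate majorants, smallness, the composite weight's two
mass clauses and the closed-form V17F budget ⟹ `PairLadderStepAtV17F2 L M G P Q β U μ n` (`1 ≤ n`).

Exact algebra; nothing about the model's sizes is asserted.  0 kit.
-/

noncomputable section

namespace Summit.HubbardSuperconductivity.HubbardSuperconductivity.Theorems.KLRegimeSplit

set_option linter.dupNamespace false -- summit = problem name (single-conjunct summit), D-0017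

open Finset Matrix Literature.MathematicalPhysics.QuantumLattice Literature.Probability.LatticeModels
open Summit.HubbardSuperconductivity.HubbardSuperconductivity.Theorems.KLProgrammeLegKernels

section Model

variable (L M : ℕ) [NeZero L] [NeZero M]

/-- Off the bare ball (either index) the truncated array vanishes. -/
theorem klPairArrayF_eq_zero_off (β U μ : ℝ) (n : ℕ) (Qm : TorusSite 2 L) (x y : TorusSite 2 L)
    (hxy : ¬(x ∈ klBall L μ 0 ∧ y ∈ klBall L μ 0)) : klPairArrayF L M β U μ n Qm x y = 0 := by
  by_cases hx : x ∈ klBall L μ 0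
  · exact klPairArrayF_apply_of_not_mem_right L M β U μ n Qm x (fun hy => hxy ⟨hx, hy⟩)
  · exact klPairArrayF_apply_of_not_mem L M β U μ n Qm hx y

/-- **(E2-F2) `PairLadderStepAtV17F2 … n` (`1 ≤ n`) from the private Wick tower, straddle relations in FORWARD form, on the bare ball.**  See the module
docstring; the per-class data are those of `pairLadderStepAtV10_of_wickTower_fwd` with `klPairArray … K j Qm ↦ klPairArrayF … j Qm`, `klBall L μ K ↦ klBall L μ 0`
and the V17F budget line. -/
theorem pairLadderStepAtV17F2_of_wickTower_fwd {G : GeoConsts} {P : SplitConsts} {Q : EngConsts} {β U μ : ℝ} {n : ℕ} {m : ℝ} (hn : 1 ≤ n)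
    (hm : 0 ≤ m) (hC₀ : ∀ Qm s t, ‖klPairArrayF L M β U μ (n - 1) Qm s t‖ ≤ m)
    (htower : ∀ Qm : TorusSite 2 L, IsPairClassAt L Qm n →
      ∃ (X Y M' N M₀ : Matrix (TorusSite 2 L) (TorusSite 2 L) ℂ) (b' w₁ b : TorusSite 2 L → ℝ)
        (R' Ea ER E₁ E₂ : TorusSite 2 L → TorusSite 2 L → ℝ) (r' eR e₁ : ℝ),
        0 ≤ r' ∧ 0 ≤ eR ∧ 0 ≤ e₁ ∧
        (∀ x y, ¬(x ∈ klBall L μ 0 ∧ y ∈ klBall L μ 0) → X x y = 0) ∧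
        (∀ x y, ¬(x ∈ klBall L μ 0 ∧ y ∈ klBall L μ 0) → Y x y = 0) ∧
        (∀ x y, 0 ≤ R' x y) ∧ (∀ x y, 0 ≤ Ea x y) ∧ (∀ x y, 0 ≤ ER x y) ∧
        (1 - diagonal (fun p => (b' p : ℂ)) * klPairArrayF L M β U μ (n - 1) Qm) * M' = 1 ∧
        (∀ k ∈ klBall L μ 0, ∀ k' ∈ klBall L μ 0, ‖X k k' - (klPairArrayF L M β U μ (n - 1) Qm * M') k k'‖ ≤ R' k k') ∧
        (∀ x y, R' x y ≤ r') ∧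
        (1 + diagonal (fun p => (w₁ p : ℂ)) * X) * N = 1 ∧
        (∀ k ∈ klBall L μ 0, ∀ k' ∈ klBall L μ 0, ‖Y k k' - (X * N) k k'‖ ≤ Ea k k') ∧
        (1 - diagonal (fun p => (b p : ℂ)) * klPairArrayF L M β U μ n Qm) * M₀ = 1 ∧
        (∀ k ∈ klBall L μ 0, ∀ k' ∈ klBall L μ 0, ‖Y k k' - (klPairArrayF L M β U μ n Qm * M₀) k k'‖ ≤ ER k k') ∧
        (∀ x y, ER x y ≤ eR) ∧
        (∀ x y, Ea x y + (R' x y + 3 / 2 * (3 / 2 * m) * ∑ t, R' x t * |w₁ t| + 3 / 2 * (3 / 2 * m + r') * ∑ a, |w₁ a| * R' a y +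
            9 / 4 * (3 / 2 * m + r') * (3 / 2 * m) * ∑ a, ∑ t, |w₁ a| * R' a t * |w₁ t|) ≤ E₁ x y) ∧
        (∀ x y, E₁ x y ≤ e₁) ∧ (∀ x y, ER x y + E₁ x y ≤ E₂ x y) ∧
        m * ∑ a, |b' a| ≤ 1 / 3 ∧ (3 / 2 * m + r') * ∑ a, |w₁ a| ≤ 1 / 3 ∧ (9 / 4 * m + e₁ + eR) * ∑ a, |b a| ≤ 1 / 3 ∧
        (∑ p, |w₁ p + b p - b' p| ≤ G.bhi) ∧
        (∑ p, (|w₁ p + b p - b' p| - (w₁ p + b p - b' p)) ≤ 2 * klEdge G n (klTorusNorm L Qm)) ∧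
        (∀ k ∈ klBall L μ 0, ∀ k' ∈ klBall L μ 0,
          E₂ k k' + 3 / 2 * (9 / 4 * m) * ∑ t, E₂ k t * |b t| + 3 / 2 * (9 / 4 * m + e₁ + eR) * ∑ a, |b a| * E₂ a k' +
              9 / 4 * (9 / 4 * m + e₁ + eR) * (9 / 4 * m) * ∑ a, ∑ t, |b a| * E₂ a t * |b t| ≤
            drivePBar G P U (n - 1) + eremBar G P Q U β L (n - 1) + thermalBar G P U β n +
              legDressBarQ2 G P Q U n (legSliceCountT L β μ (klFlowFrameU L M β U μ n) n ![k', Qm - k', Qm - k, k]) +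
              (P.Klam * U) ^ 2 * (G.phGain n (klTorusNorm L (k - k')) + G.phGain n (klTorusNorm L (k + k' - Qm))) +
              frameShiftBar P Q U n)) :
    PairLadderStepAtV17F2 L M G P Q β U μ n := by
  refine ⟨fun h0 => absurd h0 (by omega), fun _ Qm hQm => ?_⟩
  obtain ⟨X, Y, M', N, M₀, b', w₁, b, R', Ea, ER, E₁, E₂, r', eR, e₁, hr', heR, he₁, hX0, hY0, hR'0, hEa0, hER0, hM', hR', hR'e, hN,
    hEa, hM₀, hER, hERe, hE₁, hE₁e, hE₂, hsm₀, hsm₁, hsm₂, hmass, hneg, hbud⟩ := htower Qm hQm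
  obtain ⟨N₃, hN₃1, -, hbd⟩ := kltc_compose_fwd_on (klBall L μ 0) (klPairArrayF L M β U μ (n - 1) Qm) (klPairArrayF L M β U μ n Qm) X Y M' N M₀
    b' w₁ b R' Ea ER E₁ E₂ hm hr' heR he₁ (hC₀ Qm) (klPairArrayF_eq_zero_off L M β U μ (n - 1) Qm) (klPairArrayF_eq_zero_off L M β U μ n Qm)
    hX0 hY0 hR'0 hEa0 hER0 hM' hR' hR'e hN hEa hM₀ hER hERe hE₁ hE₁e hE₂ hsm₀ hsm₁ hsm₂
  refine ⟨fun p => w₁ p + b p - b' p, hmass, hneg, N₃, hN₃1, fun k hk k' hk' => ?_⟩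
  have h := hbd k hk k' hk'
  rw [klPairArrayF_apply_of_mem L M β U μ n Qm hk hk'] at h
  exact h.trans (hbud k hk k' hk')

end Model

end Summit.HubbardSuperconductivity.HubbardSuperconductivity.Theorems.KLRegimeSplit

end
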